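import Summits.QuantumFields.YangMills.Theorems.FluctuationComparisonRegPrIntLOrganTangentLawEdgeResponseDock
import Summits.QuantumFields.YangMills.Theorems.FluctuationComparisonRegPrIntLOrganTangentPullbackSquareCurvOrgan
import HarnessLib

/-!
# Crux `FluctuationComparisonRegPrIntL` (stmt-QuantumFields-20520, rung R3), PATH-B organ, H-currency cone — (L25) THE D3 INTEGRATION BRICK «(L23) + a covariance-kernel
# hypothesis ⟹ (L1ʲ-h) ∕ (L2ʲ-h)» (DISCHARGE SPEC v1.0 §6 step 4; LEAD w3 g26 №20∕№22: first refusal exercised, «the brick is YOURS, both texts»)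

Cell `ym3-torus` (YM ladder rung R3 = continuum `SU(2)` Yang–Mills on the three-torus — a RUNG: NOT d = 4, NOT infinite volume, NOT a mass gap, NOT Clay).
Width seat `ym-ust-20520-w5` (gen 24), `--supports stmt-QuantumFields-20520 --as helper`, count-neutral, no registry ∕ binder ∕ `Lines/` edit, DEFINITION-FREE,
default heartbeats.  Over ✓(L23a) `…OrganTangentLawEdgeResponse` (p815758), ✓(L24) `…OrganTangentLawSquareResponse`, ✓(L23b) `…OrganTangentLawEdgeResponseDock`, the
reviewed letters `wNum` ∕ `wgt` of ✓p812742 and ✓`OrganTangentSeedHClause.eq_update_of_rel` (relational one-bond corners = `Function.update`).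

WHAT.  For ONE instance `(t, B′, m′, U₁ V₁ U₂ W₂)` of the (L1ʲ-h) conjunct of `SpreadFibreLawH` (✓p812742) — transport edge `U₁ → V₁` (frozen in the integrand
`Δ F := F_{V₁} − F_{U₁}`, `F_X := h_Ts∘Φ(X,·)`, `h_Ts = log ρ_Ts − log ρ′_Ts`), LAW edge `U₂ → W₂` at `B′` (`(∀ e ≠ B′, W₂ e = U₂ e) ∧ W₂ B′ = U₂ B′·expPt m′`) — and ANY law path
`X : ℝ → GaugeField` with `X 0 = U₂`, `X 1 = W₂` (★`lawPath_zero` ∕ ★`lawPath_one`: the one-bond exponential path `X s := update U₂ B′ (U₂ B′·expPt (s•m′))` qualifies):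
★★★`lawEdgeClause_of_covKernel` — from (i) PATH REGULARITY of `s ↦ wNum … t (X s) z` (a derivative family `wN′`, measurability, integrability of `wNum(X s)`, `F_{U₁}·wNum(X s)`,
`F_{V₁}·wNum(X s)` on `[0,1]`, a.e. dominators of `wN′` and `ΔF·wN′` on an open `U ⊇ [0,1]`, non-zero masses — D0's chart regularity, HYPOTHESES), (i′) the CUT clause
«`wN′ s = 0` a.e. where `wNum(X s) = 0`» (soft-cut weights vanish off the multi-window), and (ii) the COVARIANCE-KERNEL clause in SCORE form (Brascamp–Lieb ∕ Helffer–Sjöstrand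
SHAPE; HYPOTHESIS — the spec's «FIBRE-LAW CLUSTER BOUNDS» row): `∀ s ∈ [0,1], |∫ ΔF·r_s·ŵ_s dτ − (∫ ΔF·ŵ_s dτ)·(∫ r_s·ŵ_s dτ)| ≤ ℓ`, `r_s := wN′ s ∕ wNum(X s)`,
`ŵ_s := wNum(X s) ∕ ∫ wNum(X s)` — TO the (L1ʲ-h) conjunct's BODY VERBATIM: the four `Integrable (F_• · wgt … t (U₂ ∕ W₂) ·) τ` facts ∧
`|((∫ F_{V₁}·ŵ_t(W₂)) − (∫ F_{U₁}·ŵ_t(W₂))) − ((∫ F_{V₁}·ŵ_t(U₂)) − (∫ F_{U₁}·ŵ_t(U₂)))| ≤ ℓ` (the row has `ℓ = kX B B′·(‖m‖∕(θ_j∕4))·(‖m′‖∕(θ_j∕4))`; the letter's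
row∕column masses live one quantifier up and are not touched here).  Engine: DOCK `abs_lawEdge_wgt_le` (✓(L23a) `abs_normMean_one_sub_zero_le`) after (L24)
`normMean_deriv_eq_cov_of_null` turns the score clause into (L23a)'s raw quotient form, `integral_sub` at the two endpoints, `Integrable.div_const` for the `wgt`-integrabilities.
★★★`lawSquareClause_of_mixedKernel` — the (L2ʲ-h) twin (law SQUARE `V00 V10 V01 V11`, frozen integrand `F_{V00}`): ANY two-parameter law path with those corners
(★`lawSquare_corners`: the exponential square `update (update V00 B (V00 B·expPt (s•m))) B′ (…·expPt (s′•m′))` qualifies), (L24)∕DOCK `abs_lawSquare_wgt_le`'s regularity data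
(partial families `w₁ w₂ w₁₂`) and a uniform bound `ℓ` of the N-form MIXED kernel (raw quotient form; score reading `κ₃(F, r₁, r₂) + Cov(F, ∂₁r₂)`) ⟹ the (L2ʲ-h) conjunct's
body VERBATIM.

HONEST FRAMING: bookkeeping [folklore]; the path regularity and the covariance kernel are HYPOTHESES (D0 ∕ «cluster bounds»), no letter is priced; nothing of Bałaban's analysis is
asserted or proved; `SpreadFibreLawH` ∕ `SpreadFibreLawHJ` are HYPOTHESIS rows; LIN″ ∕ JVAR″ ∕ JEN″ ∕ O1ᵘ-H v2.2 ∕ S1aᴴ ∕ S3ᴴ ∕ S2α′ ∕ S2β, the five registered stubs of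
`Lines/semiclassical_s2beta.lean`, crux 20520 `FluctuationComparisonRegPrIntL` and `YM3TorusSU2` are NOT proved; registry untouched; rung R3 = SU(2) YM₃ on T³ at fixed
lattice data — NOT d = 4, NOT infinite volume, NOT a mass gap, NOT Clay; the Yang–Mills mass gap is NOT proved.  [folklore].
-/

set_option autoImplicit false

noncomputable section

namespace Summit.QuantumFields.YangMills.Theorems.OrganTangentLawEdgeIntegration

open MeasureTheory Filter Topology Set Function
open scoped ENNReal
open Literature.MathematicalPhysics.QuantumFieldTheory.Balaban1983to89 T3ContinuumYM3Torus T3NestedUnitLaws T3UnitLawDensityEML T4Continuum BalabanUVClass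
open T4CubeChartExp (expPt)
open Summit.QuantumFields.YangMills.Theorems.FluctuationComparisonRegPrIntLRunpairOrganFibreLaw (wNum wgt)
open Summit.QuantumFields.YangMills.Theorems.OrganTangentLawEdgeResponse
open Summit.QuantumFields.YangMills.Theorems.OrganTangentLawSquareResponse
open Summit.QuantumFields.YangMills.Theorems.OrganTangentLawEdgeResponseDock
open Summit.QuantumFields.YangMills.Theorems.OrganTangentSeedHClause (eq_update_of_rel corner_zero_zero)
open Summit.QuantumFields.YangMills.Theorems.OrganTangentPullbackSquareCurvOrgan (sqCorner_one_zero sqCorner_zero_one sqCorner_one_one)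

/-! ## §1 The one-bond exponential law path and its endpoints -/

section Path

variable {P : Params} {j : ℕ} [DecidableEq (PBond P j)]

/-- ★ The one-bond exponential law path `X s := update U B′ (U B′·expPt (s•m′))` starts at `U` (`expPt 0 = 1`). [folklore] -/
theorem lawPath_zero (U : GaugeField P j (Matrix.specialUnitaryGroup (Fin 2) ℂ)) (B' : PBond P j) (m' : Fin 3 → ℝ) :
    update U B' (U B' * expPt ((0:ℝ) • m')) = U := by
  funext e
  rw [zero_smul, T4CubeChartExp.expPt_zero, mul_one]
  by_cases he : e = B'
  · subst he; rw [update_self]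
  · rw [update_of_ne he]

/-- ★ … and ends at the relational corner `W` (`(∀ e ≠ B′, W e = U e) ∧ W B′ = U B′·expPt m′`; ✓`OrganTangentSeedHClause.eq_update_of_rel`). [folklore] -/
theorem lawPath_one (U W : GaugeField P j (Matrix.specialUnitaryGroup (Fin 2) ℂ)) (B' : PBond P j) (m' : Fin 3 → ℝ)
    (hoff : ∀ e, e ≠ B' → W e = U e) (hB : W B' = U B' * expPt m') :
    update U B' (U B' * expPt ((1:ℝ) • m')) = W := by
  rw [one_smul]
  exact (OrganTangentSeedHClause.eq_update_of_rel hoff hB).symm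

/-- ★ The one-bond exponential law SQUARE `X s s′ := update (update U B (U B·expPt (s•m))) B′ ((update U B (U B·expPt (s•m))) B′·expPt (s′•m′))` has the relational
corners `V00 = U, V10, V01, V11` of the rows' law squares (`(∀ e ≠ B, V10 e = U e) ∧ V10 B = U B·expPt m`, `(∀ e ≠ B′, V01 e = U e) ∧ V01 B′ = U B′·expPt m′`,
`(∀ e ≠ B′, V11 e = V10 e) ∧ V11 B′ = V10 B′·expPt m′`); ✓`OrganTangentPullbackSquareCurvOrgan.sqCorner_*`, ✓`OrganTangentSeedHClause.corner_zero_zero ∕ eq_update_of_rel`.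
[folklore] -/
theorem lawSquare_corners (U V10 V01 V11 : GaugeField P j (Matrix.specialUnitaryGroup (Fin 2) ℂ)) (B B' : PBond P j) (m m' : Fin 3 → ℝ)
    (h10 : ∀ e, e ≠ B → V10 e = U e) (h10B : V10 B = U B * expPt m) (h01 : ∀ e, e ≠ B' → V01 e = U e) (h01B : V01 B' = U B' * expPt m')
    (h11 : ∀ e, e ≠ B' → V11 e = V10 e) (h11B : V11 B' = V10 B' * expPt m') :
    update (update U B (U B * expPt ((0:ℝ) • m))) B' ((update U B (U B * expPt ((0:ℝ) • m))) B' * expPt ((0:ℝ) • m')) = U ∧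
    update (update U B (U B * expPt ((1:ℝ) • m))) B' ((update U B (U B * expPt ((1:ℝ) • m))) B' * expPt ((0:ℝ) • m')) = V10 ∧
    update (update U B (U B * expPt ((0:ℝ) • m))) B' ((update U B (U B * expPt ((0:ℝ) • m))) B' * expPt ((1:ℝ) • m')) = V01 ∧
    update (update U B (U B * expPt ((1:ℝ) • m))) B' ((update U B (U B * expPt ((1:ℝ) • m))) B' * expPt ((1:ℝ) • m')) = V11 := by
  have hV10 : V10 = update U B (U B * expPt m) := eq_update_of_rel h10 h10B
  have hV01 : V01 = update U B' (U B' * expPt m') := eq_update_of_rel h01 h01B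
  have hV11 : V11 = update (update U B (U B * expPt m)) B' ((update U B (U B * expPt m)) B' * expPt m') := by
    rw [eq_update_of_rel h11 h11B, hV10]
  refine ⟨corner_zero_zero U B B' m m', ?_, ?_, ?_⟩
  · rw [sqCorner_one_zero, hV10]
  · rw [sqCorner_zero_one, hV01]
  · rw [sqCorner_one_one, hV11]

end Path

/-! ## §2 `wgt`-integrability from `wNum`-integrability -/

section Wgt

/-- `Integrable (f·wgt … t V)` from `Integrable (f·wNum … t V)` (`wgt = wNum ∕ const`; Mathlib `Integrable.div_const`). [folklore] -/
theorem integrable_mul_wgt_of_wNum (F : T3Family) (γ b₀ p₀ : ℝ) (j Ts : ℕ)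
    (ρ ρ' : (i : ℕ) → GaugeField (F.P i) 0 ↥(Matrix.specialUnitaryGroup (Fin 2) ℂ) → ℝ) {Zc : Type} [MeasurableSpace Zc] (τ : Measure Zc)
    (Φ : GaugeField (F.P j) 0 ↥(Matrix.specialUnitaryGroup (Fin 2) ℂ) × Zc → GaugeField (F.P Ts) 0 ↥(Matrix.specialUnitaryGroup (Fin 2) ℂ))
    (J : GaugeField (F.P j) 0 ↥(Matrix.specialUnitaryGroup (Fin 2) ℂ) × Zc → NNReal) (t : ℝ)
    (V : GaugeField (F.P j) 0 ↥(Matrix.specialUnitaryGroup (Fin 2) ℂ)) (f : Zc → ℝ)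
    (h : Integrable (fun z => f z * wNum F γ b₀ p₀ j Ts ρ ρ' Φ J t V z) τ) :
    Integrable (fun z => f z * (wgt F γ b₀ p₀ j Ts ρ ρ' τ Φ J t) V z) τ := by
  have e : (fun z => f z * (wgt F γ b₀ p₀ j Ts ρ ρ' τ Φ J t) V z)
      = fun z => f z * wNum F γ b₀ p₀ j Ts ρ ρ' Φ J t V z / (∫ z', wNum F γ b₀ p₀ j Ts ρ ρ' Φ J t V z' ∂τ) := by
    funext z; simp only [wgt]; ring
  rw [e]
  exact h.div_const _

end Wgt


/-! ## §3 The brick: (L1ʲ-h)'s body from path regularity + the covariance kernel -/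

section Brick

/-- ★★★ **THE D3 INTEGRATION BRICK FOR (L1ʲ-h)** (see the module docstring): path regularity of `s ↦ wNum … t (X s) ·` along ANY law path `X` from `U₂` to `W₂`
(derivative family `wN′`, dominators on an open `U ⊇ [0,1]`, masses `≠ 0`), the cut clause «`wN′ s = 0` a.e. where `wNum(X s) = 0`», and the SCORE-form covariance
kernel bound `ℓ` on `[0,1]` for the frozen transported difference `ΔF = F_{V₁} − F_{U₁}` ⟹ the (L1ʲ-h) conjunct's body of ✓p812742 VERBATIM (four `Integrable` facts and
the mixed bracket `≤ ℓ`).  All analytic content is in the hypotheses. [folklore] -/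
theorem lawEdgeClause_of_covKernel (F : T3Family) (γ b₀ p₀ : ℝ) (j Ts : ℕ)
    (ρ ρ' : (i : ℕ) → GaugeField (F.P i) 0 ↥(Matrix.specialUnitaryGroup (Fin 2) ℂ) → ℝ) {Zc : Type} [MeasurableSpace Zc] (τ : Measure Zc)
    (Φ : GaugeField (F.P j) 0 ↥(Matrix.specialUnitaryGroup (Fin 2) ℂ) × Zc → GaugeField (F.P Ts) 0 ↥(Matrix.specialUnitaryGroup (Fin 2) ℂ))
    (J : GaugeField (F.P j) 0 ↥(Matrix.specialUnitaryGroup (Fin 2) ℂ) × Zc → NNReal) (t : ℝ)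
    (U₁ V₁ U₂ W₂ : GaugeField (F.P j) 0 ↥(Matrix.specialUnitaryGroup (Fin 2) ℂ))
    (X : ℝ → GaugeField (F.P j) 0 ↥(Matrix.specialUnitaryGroup (Fin 2) ℂ)) (hX0 : X 0 = U₂) (hX1 : X 1 = W₂)
    (wN' : ℝ → Zc → ℝ) {U : Set ℝ} (hU : IsOpen U) (hUI : Icc (0:ℝ) 1 ⊆ U)
    (hmF : AEStronglyMeasurable (fun z => (Real.log (ρ Ts (Φ (V₁, z))) - Real.log (ρ' Ts (Φ (V₁, z))))
      - (Real.log (ρ Ts (Φ (U₁, z))) - Real.log (ρ' Ts (Φ (U₁, z))))) τ)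
    (hm : ∀ s, AEStronglyMeasurable (fun z => wNum F γ b₀ p₀ j Ts ρ ρ' Φ J t (X s) z) τ) (hm' : ∀ s, AEStronglyMeasurable (wN' s) τ)
    (hi : ∀ s ∈ Icc (0:ℝ) 1, Integrable (fun z => wNum F γ b₀ p₀ j Ts ρ ρ' Φ J t (X s) z) τ)
    (hiU : ∀ s ∈ Icc (0:ℝ) 1, Integrable (fun z => (Real.log (ρ Ts (Φ (U₁, z))) - Real.log (ρ' Ts (Φ (U₁, z)))) * wNum F γ b₀ p₀ j Ts ρ ρ' Φ J t (X s) z) τ)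
    (hiV : ∀ s ∈ Icc (0:ℝ) 1, Integrable (fun z => (Real.log (ρ Ts (Φ (V₁, z))) - Real.log (ρ' Ts (Φ (V₁, z)))) * wNum F γ b₀ p₀ j Ts ρ ρ' Φ J t (X s) z) τ)
    {bound : Zc → ℝ} (hb : ∀ᵐ z ∂τ, ∀ s ∈ U, |wN' s z| ≤ bound z) (hbi : Integrable bound τ)
    {boundG : Zc → ℝ} (hbG : ∀ᵐ z ∂τ, ∀ s ∈ U, |((Real.log (ρ Ts (Φ (V₁, z))) - Real.log (ρ' Ts (Φ (V₁, z))))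
      - (Real.log (ρ Ts (Φ (U₁, z))) - Real.log (ρ' Ts (Φ (U₁, z))))) * wN' s z| ≤ boundG z) (hbGi : Integrable boundG τ)
    (hd : ∀ᵐ z ∂τ, ∀ s ∈ U, HasDerivAt (fun s => wNum F γ b₀ p₀ j Ts ρ ρ' Φ J t (X s) z) (wN' s z) s)
    (hZ : ∀ s ∈ Icc (0:ℝ) 1, ∫ z, wNum F γ b₀ p₀ j Ts ρ ρ' Φ J t (X s) z ∂τ ≠ 0)
    (hnull : ∀ s ∈ Icc (0:ℝ) 1, ∀ᵐ z ∂τ, wNum F γ b₀ p₀ j Ts ρ ρ' Φ J t (X s) z = 0 → wN' s z = 0) {ℓ : ℝ}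
    (hcov : ∀ s ∈ Icc (0:ℝ) 1,
      |(∫ z, ((Real.log (ρ Ts (Φ (V₁, z))) - Real.log (ρ' Ts (Φ (V₁, z)))) - (Real.log (ρ Ts (Φ (U₁, z))) - Real.log (ρ' Ts (Φ (U₁, z)))))
            * (wN' s z / wNum F γ b₀ p₀ j Ts ρ ρ' Φ J t (X s) z)
            * (wNum F γ b₀ p₀ j Ts ρ ρ' Φ J t (X s) z / ∫ z', wNum F γ b₀ p₀ j Ts ρ ρ' Φ J t (X s) z' ∂τ) ∂τ)
        - (∫ z, ((Real.log (ρ Ts (Φ (V₁, z))) - Real.log (ρ' Ts (Φ (V₁, z)))) - (Real.log (ρ Ts (Φ (U₁, z))) - Real.log (ρ' Ts (Φ (U₁, z)))))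
            * (wNum F γ b₀ p₀ j Ts ρ ρ' Φ J t (X s) z / ∫ z', wNum F γ b₀ p₀ j Ts ρ ρ' Φ J t (X s) z' ∂τ) ∂τ)
          * (∫ z, (wN' s z / wNum F γ b₀ p₀ j Ts ρ ρ' Φ J t (X s) z)
            * (wNum F γ b₀ p₀ j Ts ρ ρ' Φ J t (X s) z / ∫ z', wNum F γ b₀ p₀ j Ts ρ ρ' Φ J t (X s) z' ∂τ) ∂τ)| ≤ ℓ) :
    Integrable (fun z => (Real.log (ρ Ts (Φ (U₁, z))) - Real.log (ρ' Ts (Φ (U₁, z)))) * (wgt F γ b₀ p₀ j Ts ρ ρ' τ Φ J t) U₂ z) τ ∧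
    Integrable (fun z => (Real.log (ρ Ts (Φ (V₁, z))) - Real.log (ρ' Ts (Φ (V₁, z)))) * (wgt F γ b₀ p₀ j Ts ρ ρ' τ Φ J t) U₂ z) τ ∧
    Integrable (fun z => (Real.log (ρ Ts (Φ (U₁, z))) - Real.log (ρ' Ts (Φ (U₁, z)))) * (wgt F γ b₀ p₀ j Ts ρ ρ' τ Φ J t) W₂ z) τ ∧
    Integrable (fun z => (Real.log (ρ Ts (Φ (V₁, z))) - Real.log (ρ' Ts (Φ (V₁, z)))) * (wgt F γ b₀ p₀ j Ts ρ ρ' τ Φ J t) W₂ z) τ ∧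
    |((∫ z, (Real.log (ρ Ts (Φ (V₁, z))) - Real.log (ρ' Ts (Φ (V₁, z)))) * (wgt F γ b₀ p₀ j Ts ρ ρ' τ Φ J t) W₂ z ∂τ)
        - (∫ z, (Real.log (ρ Ts (Φ (U₁, z))) - Real.log (ρ' Ts (Φ (U₁, z)))) * (wgt F γ b₀ p₀ j Ts ρ ρ' τ Φ J t) W₂ z ∂τ))
      - ((∫ z, (Real.log (ρ Ts (Φ (V₁, z))) - Real.log (ρ' Ts (Φ (V₁, z)))) * (wgt F γ b₀ p₀ j Ts ρ ρ' τ Φ J t) U₂ z ∂τ)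
        - (∫ z, (Real.log (ρ Ts (Φ (U₁, z))) - Real.log (ρ' Ts (Φ (U₁, z)))) * (wgt F γ b₀ p₀ j Ts ρ ρ' τ Φ J t) U₂ z ∂τ))| ≤ ℓ := by
  have h1 : (1:ℝ) ∈ Icc (0:ℝ) 1 := ⟨zero_le_one, le_rfl⟩
  have h0 : (0:ℝ) ∈ Icc (0:ℝ) 1 := ⟨le_rfl, zero_le_one⟩
  -- the four `wgt`-integrabilities at the endpoints
  have iUU := integrable_mul_wgt_of_wNum F γ b₀ p₀ j Ts ρ ρ' τ Φ J t (X 0) _ (hiU 0 h0)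
  have iVU := integrable_mul_wgt_of_wNum F γ b₀ p₀ j Ts ρ ρ' τ Φ J t (X 0) _ (hiV 0 h0)
  have iUW := integrable_mul_wgt_of_wNum F γ b₀ p₀ j Ts ρ ρ' τ Φ J t (X 1) _ (hiU 1 h1)
  have iVW := integrable_mul_wgt_of_wNum F γ b₀ p₀ j Ts ρ ρ' τ Φ J t (X 1) _ (hiV 1 h1)
  rw [hX0] at iUU iVU
  rw [hX1] at iUW iVW
  -- integrability of the transported difference against `wNum (X s)`
  have hiG : ∀ s ∈ Icc (0:ℝ) 1, Integrable (fun z => ((Real.log (ρ Ts (Φ (V₁, z))) - Real.log (ρ' Ts (Φ (V₁, z))))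
      - (Real.log (ρ Ts (Φ (U₁, z))) - Real.log (ρ' Ts (Φ (U₁, z))))) * wNum F γ b₀ p₀ j Ts ρ ρ' Φ J t (X s) z) τ := by
    intro s hs
    have e : (fun z => ((Real.log (ρ Ts (Φ (V₁, z))) - Real.log (ρ' Ts (Φ (V₁, z))))
        - (Real.log (ρ Ts (Φ (U₁, z))) - Real.log (ρ' Ts (Φ (U₁, z))))) * wNum F γ b₀ p₀ j Ts ρ ρ' Φ J t (X s) z)
        = fun z => (Real.log (ρ Ts (Φ (V₁, z))) - Real.log (ρ' Ts (Φ (V₁, z)))) * wNum F γ b₀ p₀ j Ts ρ ρ' Φ J t (X s) z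
          - (Real.log (ρ Ts (Φ (U₁, z))) - Real.log (ρ' Ts (Φ (U₁, z)))) * wNum F γ b₀ p₀ j Ts ρ ρ' Φ J t (X s) z := by
      funext z; ring
    rw [e]
    exact (hiV s hs).sub (hiU s hs)
  -- the covariance kernel in (L23a)'s raw quotient form, via (L24)'s cut-weight score identity
  have hraw : ∀ s ∈ Icc (0:ℝ) 1,
      |(∫ z, ((Real.log (ρ Ts (Φ (V₁, z))) - Real.log (ρ' Ts (Φ (V₁, z)))) - (Real.log (ρ Ts (Φ (U₁, z))) - Real.log (ρ' Ts (Φ (U₁, z)))))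
            * wN' s z ∂τ) / (∫ z, wNum F γ b₀ p₀ j Ts ρ ρ' Φ J t (X s) z ∂τ)
        - ((∫ z, ((Real.log (ρ Ts (Φ (V₁, z))) - Real.log (ρ' Ts (Φ (V₁, z)))) - (Real.log (ρ Ts (Φ (U₁, z))) - Real.log (ρ' Ts (Φ (U₁, z)))))
            * wNum F γ b₀ p₀ j Ts ρ ρ' Φ J t (X s) z ∂τ) / (∫ z, wNum F γ b₀ p₀ j Ts ρ ρ' Φ J t (X s) z ∂τ))
          * ((∫ z, wN' s z ∂τ) / (∫ z, wNum F γ b₀ p₀ j Ts ρ ρ' Φ J t (X s) z ∂τ))| ≤ ℓ := by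
    intro s hs
    rw [normMean_deriv_eq_cov_of_null (w := fun s z => wNum F γ b₀ p₀ j Ts ρ ρ' Φ J t (X s) z) (w' := wN')
      (G := fun z => (Real.log (ρ Ts (Φ (V₁, z))) - Real.log (ρ' Ts (Φ (V₁, z)))) - (Real.log (ρ Ts (Φ (U₁, z))) - Real.log (ρ' Ts (Φ (U₁, z)))))
      (s₀ := s) (hnull s hs)]
    exact hcov s hs
  -- the edge (DOCK) and the endpoint bookkeeping
  have hedge := abs_lawEdge_wgt_le F γ b₀ p₀ j Ts ρ ρ' τ Φ J t X
    (fun z => (Real.log (ρ Ts (Φ (V₁, z))) - Real.log (ρ' Ts (Φ (V₁, z)))) - (Real.log (ρ Ts (Φ (U₁, z))) - Real.log (ρ' Ts (Φ (U₁, z)))))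
    wN' hU hUI hmF hm hm' hi hiG hb hbi hbG hbGi hd hZ hraw
  rw [hX0, hX1] at hedge
  have eW : (∫ z, ((Real.log (ρ Ts (Φ (V₁, z))) - Real.log (ρ' Ts (Φ (V₁, z)))) - (Real.log (ρ Ts (Φ (U₁, z))) - Real.log (ρ' Ts (Φ (U₁, z)))))
        * (wgt F γ b₀ p₀ j Ts ρ ρ' τ Φ J t) W₂ z ∂τ)
      = (∫ z, (Real.log (ρ Ts (Φ (V₁, z))) - Real.log (ρ' Ts (Φ (V₁, z)))) * (wgt F γ b₀ p₀ j Ts ρ ρ' τ Φ J t) W₂ z ∂τ)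
        - (∫ z, (Real.log (ρ Ts (Φ (U₁, z))) - Real.log (ρ' Ts (Φ (U₁, z)))) * (wgt F γ b₀ p₀ j Ts ρ ρ' τ Φ J t) W₂ z ∂τ) := by
    rw [← integral_sub iVW iUW]
    exact integral_congr_ae (Eventually.of_forall fun z => by ring)
  have eU : (∫ z, ((Real.log (ρ Ts (Φ (V₁, z))) - Real.log (ρ' Ts (Φ (V₁, z)))) - (Real.log (ρ Ts (Φ (U₁, z))) - Real.log (ρ' Ts (Φ (U₁, z)))))
        * (wgt F γ b₀ p₀ j Ts ρ ρ' τ Φ J t) U₂ z ∂τ)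
      = (∫ z, (Real.log (ρ Ts (Φ (V₁, z))) - Real.log (ρ' Ts (Φ (V₁, z)))) * (wgt F γ b₀ p₀ j Ts ρ ρ' τ Φ J t) U₂ z ∂τ)
        - (∫ z, (Real.log (ρ Ts (Φ (U₁, z))) - Real.log (ρ' Ts (Φ (U₁, z)))) * (wgt F γ b₀ p₀ j Ts ρ ρ' τ Φ J t) U₂ z ∂τ) := by
    rw [← integral_sub iVU iUU]
    exact integral_congr_ae (Eventually.of_forall fun z => by ring)
  rw [eW, eU] at hedge
  exact ⟨iUU, iVU, iUW, iVW, hedge⟩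

/-- ★★★ **THE D3 INTEGRATION BRICK FOR (L2ʲ-h)** (law square, frozen integrand `F_{V00}`): for ANY two-parameter law path `X` with corners `X 0 0 = V00`, `X 1 0 = V10`,
`X 0 1 = V01`, `X 1 1 = V11` (★`lawSquare_corners`: the exponential square qualifies), (L24) ∕ DOCK `abs_lawSquare_wgt_le`'s path-regularity data for
`w s s′ z := wNum … t (X s s′) z` (partial families `w₁ w₂ w₁₂`, six dominators on an open `U ⊇ [0,1]`, masses `≠ 0`) and a uniform bound `ℓ` of the N-form mixed bracket
(the second-order covariance kernel, raw quotient form; score reading `κ₃(F, r₁, r₂) + Cov(F, ∂₁r₂)`) on `[0,1]²` ⟹ the (L2ʲ-h) conjunct's body of ✓p812742 VERBATIM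
(four `Integrable` facts and `|(∫F·ŵ(V11)) − (∫F·ŵ(V10)) − (∫F·ŵ(V01)) + (∫F·ŵ(V00))| ≤ ℓ`). [folklore] -/
theorem lawSquareClause_of_mixedKernel (F : T3Family) (γ b₀ p₀ : ℝ) (j Ts : ℕ)
    (ρ ρ' : (i : ℕ) → GaugeField (F.P i) 0 ↥(Matrix.specialUnitaryGroup (Fin 2) ℂ) → ℝ) {Zc : Type} [MeasurableSpace Zc] (τ : Measure Zc)
    (Φ : GaugeField (F.P j) 0 ↥(Matrix.specialUnitaryGroup (Fin 2) ℂ) × Zc → GaugeField (F.P Ts) 0 ↥(Matrix.specialUnitaryGroup (Fin 2) ℂ))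
    (J : GaugeField (F.P j) 0 ↥(Matrix.specialUnitaryGroup (Fin 2) ℂ) × Zc → NNReal) (t : ℝ)
    (V00 V10 V01 V11 : GaugeField (F.P j) 0 ↥(Matrix.specialUnitaryGroup (Fin 2) ℂ))
    (X : ℝ → ℝ → GaugeField (F.P j) 0 ↥(Matrix.specialUnitaryGroup (Fin 2) ℂ)) (hX00 : X 0 0 = V00) (hX10 : X 1 0 = V10) (hX01 : X 0 1 = V01)
    (hX11 : X 1 1 = V11) (w₁ w₂ w₁₂ : ℝ → ℝ → Zc → ℝ) {U : Set ℝ} (hU : IsOpen U) (hUI : Icc (0:ℝ) 1 ⊆ U)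
    (hmF : AEStronglyMeasurable (fun z => Real.log (ρ Ts (Φ (V00, z))) - Real.log (ρ' Ts (Φ (V00, z)))) τ)
    (hm : ∀ s s', AEStronglyMeasurable (fun z => wNum F γ b₀ p₀ j Ts ρ ρ' Φ J t (X s s') z) τ)
    (hm₁ : ∀ s s', AEStronglyMeasurable (w₁ s s') τ) (hm₂ : ∀ s s', AEStronglyMeasurable (w₂ s s') τ) (hm₁₂ : ∀ s s', AEStronglyMeasurable (w₁₂ s s') τ)
    (hi : ∀ s ∈ Icc (0:ℝ) 1, ∀ s' ∈ Icc (0:ℝ) 1, Integrable (fun z => wNum F γ b₀ p₀ j Ts ρ ρ' Φ J t (X s s') z) τ)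
    (hiG : ∀ s ∈ Icc (0:ℝ) 1, ∀ s' ∈ Icc (0:ℝ) 1,
      Integrable (fun z => (Real.log (ρ Ts (Φ (V00, z))) - Real.log (ρ' Ts (Φ (V00, z)))) * wNum F γ b₀ p₀ j Ts ρ ρ' Φ J t (X s s') z) τ)
    (hi₂ : ∀ s ∈ Icc (0:ℝ) 1, ∀ s' ∈ Icc (0:ℝ) 1, Integrable (w₂ s s') τ)
    (hiG₂ : ∀ s ∈ Icc (0:ℝ) 1, ∀ s' ∈ Icc (0:ℝ) 1, Integrable (fun z => (Real.log (ρ Ts (Φ (V00, z))) - Real.log (ρ' Ts (Φ (V00, z)))) * w₂ s s' z) τ)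
    {b₁ : Zc → ℝ} (hb₁ : ∀ᵐ z ∂τ, ∀ s ∈ U, ∀ s' ∈ U, |w₁ s s' z| ≤ b₁ z) (hb₁i : Integrable b₁ τ)
    {b₁G : Zc → ℝ} (hb₁G : ∀ᵐ z ∂τ, ∀ s ∈ U, ∀ s' ∈ U, |(Real.log (ρ Ts (Φ (V00, z))) - Real.log (ρ' Ts (Φ (V00, z)))) * w₁ s s' z| ≤ b₁G z)
    (hb₁Gi : Integrable b₁G τ)
    {b₂ : Zc → ℝ} (hb₂ : ∀ᵐ z ∂τ, ∀ s ∈ U, ∀ s' ∈ U, |w₂ s s' z| ≤ b₂ z) (hb₂i : Integrable b₂ τ)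
    {b₂G : Zc → ℝ} (hb₂G : ∀ᵐ z ∂τ, ∀ s ∈ U, ∀ s' ∈ U, |(Real.log (ρ Ts (Φ (V00, z))) - Real.log (ρ' Ts (Φ (V00, z)))) * w₂ s s' z| ≤ b₂G z)
    (hb₂Gi : Integrable b₂G τ)
    {b₁₂ : Zc → ℝ} (hb₁₂ : ∀ᵐ z ∂τ, ∀ s ∈ U, ∀ s' ∈ U, |w₁₂ s s' z| ≤ b₁₂ z) (hb₁₂i : Integrable b₁₂ τ)
    {b₁₂G : Zc → ℝ} (hb₁₂G : ∀ᵐ z ∂τ, ∀ s ∈ U, ∀ s' ∈ U, |(Real.log (ρ Ts (Φ (V00, z))) - Real.log (ρ' Ts (Φ (V00, z)))) * w₁₂ s s' z| ≤ b₁₂G z)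
    (hb₁₂Gi : Integrable b₁₂G τ)
    (hd₂ : ∀ᵐ z ∂τ, ∀ s ∈ U, ∀ s' ∈ U, HasDerivAt (fun s' => wNum F γ b₀ p₀ j Ts ρ ρ' Φ J t (X s s') z) (w₂ s s' z) s')
    (hd₁ : ∀ᵐ z ∂τ, ∀ s ∈ U, ∀ s' ∈ U, HasDerivAt (fun s => wNum F γ b₀ p₀ j Ts ρ ρ' Φ J t (X s s') z) (w₁ s s' z) s)
    (hd₁₂ : ∀ᵐ z ∂τ, ∀ s ∈ U, ∀ s' ∈ U, HasDerivAt (fun s => w₂ s s' z) (w₁₂ s s' z) s)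
    (hZ : ∀ s ∈ Icc (0:ℝ) 1, ∀ s' ∈ Icc (0:ℝ) 1, ∫ z, wNum F γ b₀ p₀ j Ts ρ ρ' Φ J t (X s s') z ∂τ ≠ 0) {ℓ : ℝ}
    (hker : ∀ s ∈ Icc (0:ℝ) 1, ∀ s' ∈ Icc (0:ℝ) 1,
      |(((∫ z, (Real.log (ρ Ts (Φ (V00, z))) - Real.log (ρ' Ts (Φ (V00, z)))) * w₁₂ s s' z ∂τ) / (∫ z, wNum F γ b₀ p₀ j Ts ρ ρ' Φ J t (X s s') z ∂τ)
          - ((∫ z, (Real.log (ρ Ts (Φ (V00, z))) - Real.log (ρ' Ts (Φ (V00, z)))) * w₂ s s' z ∂τ) / (∫ z, wNum F γ b₀ p₀ j Ts ρ ρ' Φ J t (X s s') z ∂τ))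
            * ((∫ z, w₁ s s' z ∂τ) / (∫ z, wNum F γ b₀ p₀ j Ts ρ ρ' Φ J t (X s s') z ∂τ)))
        - ((((∫ z, (Real.log (ρ Ts (Φ (V00, z))) - Real.log (ρ' Ts (Φ (V00, z)))) * w₁ s s' z ∂τ) / (∫ z, wNum F γ b₀ p₀ j Ts ρ ρ' Φ J t (X s s') z ∂τ)
              - ((∫ z, (Real.log (ρ Ts (Φ (V00, z))) - Real.log (ρ' Ts (Φ (V00, z)))) * wNum F γ b₀ p₀ j Ts ρ ρ' Φ J t (X s s') z ∂τ)
                  / (∫ z, wNum F γ b₀ p₀ j Ts ρ ρ' Φ J t (X s s') z ∂τ))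
                * ((∫ z, w₁ s s' z ∂τ) / (∫ z, wNum F γ b₀ p₀ j Ts ρ ρ' Φ J t (X s s') z ∂τ)))
            * ((∫ z, w₂ s s' z ∂τ) / (∫ z, wNum F γ b₀ p₀ j Ts ρ ρ' Φ J t (X s s') z ∂τ)))
          + ((∫ z, (Real.log (ρ Ts (Φ (V00, z))) - Real.log (ρ' Ts (Φ (V00, z)))) * wNum F γ b₀ p₀ j Ts ρ ρ' Φ J t (X s s') z ∂τ)
              / (∫ z, wNum F γ b₀ p₀ j Ts ρ ρ' Φ J t (X s s') z ∂τ))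
            * ((∫ z, w₁₂ s s' z ∂τ) / (∫ z, wNum F γ b₀ p₀ j Ts ρ ρ' Φ J t (X s s') z ∂τ)
              - ((∫ z, w₂ s s' z ∂τ) / (∫ z, wNum F γ b₀ p₀ j Ts ρ ρ' Φ J t (X s s') z ∂τ))
                * ((∫ z, w₁ s s' z ∂τ) / (∫ z, wNum F γ b₀ p₀ j Ts ρ ρ' Φ J t (X s s') z ∂τ)))))| ≤ ℓ) :
    Integrable (fun z => (Real.log (ρ Ts (Φ (V00, z))) - Real.log (ρ' Ts (Φ (V00, z)))) * (wgt F γ b₀ p₀ j Ts ρ ρ' τ Φ J t) V00 z) τ ∧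
    Integrable (fun z => (Real.log (ρ Ts (Φ (V00, z))) - Real.log (ρ' Ts (Φ (V00, z)))) * (wgt F γ b₀ p₀ j Ts ρ ρ' τ Φ J t) V10 z) τ ∧
    Integrable (fun z => (Real.log (ρ Ts (Φ (V00, z))) - Real.log (ρ' Ts (Φ (V00, z)))) * (wgt F γ b₀ p₀ j Ts ρ ρ' τ Φ J t) V01 z) τ ∧
    Integrable (fun z => (Real.log (ρ Ts (Φ (V00, z))) - Real.log (ρ' Ts (Φ (V00, z)))) * (wgt F γ b₀ p₀ j Ts ρ ρ' τ Φ J t) V11 z) τ ∧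
    |(∫ z, (Real.log (ρ Ts (Φ (V00, z))) - Real.log (ρ' Ts (Φ (V00, z)))) * (wgt F γ b₀ p₀ j Ts ρ ρ' τ Φ J t) V11 z ∂τ)
      - (∫ z, (Real.log (ρ Ts (Φ (V00, z))) - Real.log (ρ' Ts (Φ (V00, z)))) * (wgt F γ b₀ p₀ j Ts ρ ρ' τ Φ J t) V10 z ∂τ)
      - (∫ z, (Real.log (ρ Ts (Φ (V00, z))) - Real.log (ρ' Ts (Φ (V00, z)))) * (wgt F γ b₀ p₀ j Ts ρ ρ' τ Φ J t) V01 z ∂τ)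
      + (∫ z, (Real.log (ρ Ts (Φ (V00, z))) - Real.log (ρ' Ts (Φ (V00, z)))) * (wgt F γ b₀ p₀ j Ts ρ ρ' τ Φ J t) V00 z ∂τ)| ≤ ℓ := by
  have h1 : (1:ℝ) ∈ Icc (0:ℝ) 1 := ⟨zero_le_one, le_rfl⟩
  have h0 : (0:ℝ) ∈ Icc (0:ℝ) 1 := ⟨le_rfl, zero_le_one⟩
  have i00 := integrable_mul_wgt_of_wNum F γ b₀ p₀ j Ts ρ ρ' τ Φ J t (X 0 0) _ (hiG 0 h0 0 h0)
  have i10 := integrable_mul_wgt_of_wNum F γ b₀ p₀ j Ts ρ ρ' τ Φ J t (X 1 0) _ (hiG 1 h1 0 h0)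
  have i01 := integrable_mul_wgt_of_wNum F γ b₀ p₀ j Ts ρ ρ' τ Φ J t (X 0 1) _ (hiG 0 h0 1 h1)
  have i11 := integrable_mul_wgt_of_wNum F γ b₀ p₀ j Ts ρ ρ' τ Φ J t (X 1 1) _ (hiG 1 h1 1 h1)
  rw [hX00] at i00
  rw [hX10] at i10
  rw [hX01] at i01
  rw [hX11] at i11
  have hsq := abs_lawSquare_wgt_le F γ b₀ p₀ j Ts ρ ρ' τ Φ J t X (fun z => Real.log (ρ Ts (Φ (V00, z))) - Real.log (ρ' Ts (Φ (V00, z))))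
    w₁ w₂ w₁₂ hU hUI hmF hm hm₁ hm₂ hm₁₂ hi hiG hi₂ hiG₂ hb₁ hb₁i hb₁G hb₁Gi hb₂ hb₂i hb₂G hb₂Gi hb₁₂ hb₁₂i hb₁₂G hb₁₂Gi hd₂ hd₁ hd₁₂ hZ hker
  rw [hX00, hX10, hX01, hX11] at hsq
  exact ⟨i00, i10, i01, i11, hsq⟩

end Brick

end Summit.QuantumFields.YangMills.Theorems.OrganTangentLawEdgeIntegration

end
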